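import Literature.Geometry.Kaehler.ComplexTorusLefschetzGroupPiNonCMEllipticCurvesProduct
import HarnessLib

/-!
# Curves WITH MULTIPLICITIES: `Hg(E_{c(1)} × ⋯ × E_{c(K)} × Y) = Δ_c(SL₂^m) × Hg(Y)` for a colouring
# `c : {1, …, K} ↠ {1, …, m}` of the factors by pairwise non-isogenous curves `E₁, …, E_m` without complex
# multiplication and ANY complex torus `Y` with commutative `Hg(Y)(ℂ)` — "we can identify `Hg(X₁^{n₁} × ⋯ × X_r^{n_r})`
# with `Hg(X₁ × ⋯ × X_r)`" (Moonen–Zarhin §1) inside Hazama's theorem (2), and Imai's §3 Remarks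
# "`Hg(∏_{i,j} E_i^{(j)}) = ∏_i Δ_{m_i}(Hg(E_i))`" for the curves without complex multiplication (torus level)

Layer `Literature/Geometry/Kaehler`, namespace `Literature.Geometry.Kaehler.ComplexTorus`; lane `lit-hodgefound`
(Track 2 foundations library), Layer A4 (Hodge groups of products, known cases); prover seat `lit-hodgefound-p17`
(generation 36, self-proposed row g36-#5 = the multiplicities sequel of g36-#1, seat sheet FREE POINTER (S)). Consumed
BY NAME, nothing restated: g36-#1 `ComplexTorusHodgeGroupPiNonCMEllipticCurvesProduct` (Ribet's lemma with a
commutative extra factor `inl_mulSingle_mem_of_pairwise`; the carrier lemmas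
`exists_eq_blockDiagC_piBlockDiagSLC_of_mem_hodgeGroupC_pi_prod`, `blockDiagC_piBlockDiagSLC_cocharCurveSL_mem_hodgeGroupC_pi_prod`,
`blockDiagC_piBlockDiagSLC_map_ringEquiv_mem_hodgeGroupC_pi_prod_iff`, `map_ofRealHom_blockDiag_piBlockDiagSL`,
`exists_eq_blockDiag_piBlockDiagSL_of_mem_hodgeGroup_pi_prod`; the single projections
`exists_blockDiagC_piBlockDiagSLC_mem_hodgeGroupC_pi_prod_apply_eq` — which need NO `Hom`-orthogonality, so they serve a
family with repeated factors), p22 `ComplexTorusHodgeGroupPiEllipticCurves` (`prod_eq_top_of_subgroup`,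
`SL2C.eq_top_of_forall_commutator_mem`, `exists_eq_piBlockDiagSLC_of_mem_hodgeGroupC_pi`, `map_ofRealHom_piBlockDiagSL`),
p22 `ComplexTorusLefschetzGroupFiniteProduct` (`blockSingle`, `blockSingle_mem_endAlgRat_pi`, the `piBlock` calculus),
p40 `ComplexTorusHodgeGroupComplexCommutant` (`map_mem_hodgeGroupCCommutant_of_mem_endAlgRat`: `Hg(X)(ℂ)` centralises
`End_ℚ(X)`), `ComplexTorusEndomorphismAlgebraProduct` (`fromBlocks_mem_endAlgRat_prod_iff`),
`ComplexTorusHodgeGroupProductNonCMEllipticCurve` (`blockDiagC_inr_mem_hodgeGroupC_prod`, `snd_mem_hodgeGroupC_of_blockDiagC_mem`,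
`fst_mem_hodgeGroupC_of_blockDiagC_mem`, `hodgeGroupC_ellipticPeriod_mul_comm_of_ne_bot`, §10
`IsRiemannForm.hodgeGroup_prod_eq_lefschetzGroup_of_eq`), g36-#2 `ComplexTorusHodgeClassesPiNonCMEllipticCurvesProduct`
(`hodgePoincare_prod_eq_mul_of_prod_le_hodgeGroup`, `divisorClasses_pi_eq_hodgeClasses_of_rank_one`,
`divisorClasses_sigmaPiPeriod_eq_hodgeClasses_of_coe_eq_range`), `ComplexTorusHodgeClassesProductHodgeGroup` §5
(`finrank_hodgeClasses_prod_eq_sum_of_prod_le_hodgeGroup`, `divisorClasses_prod_eq_hodgeClasses_of_prod_le_hodgeGroup`), g36-#4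
`ComplexTorusLefschetzGroupPiNonCMEllipticCurvesProduct` (`homRat_swap_eq_bot_of_hodgeGroup_prodPeriod_eq_map_blockDiag`),
`ComplexTorusLefschetzGroupProduct` (`IsRiemannForm.lefschetzGroup_prod_eq`, `blockDiag_mem_lefschetzGroup_prod`),
`ComplexTorusLefschetzGroupFiniteProduct` (`IsRiemannForm.pi`, `IsRiemannForm.lefschetzGroup_pi_le`), g33
`ComplexTorusHodgeGroupHodgeCircleSigmaPiLefschetz` and g35-#2 (`hodgeGroupC_sigmaPiPeriod_comm_of_coe_eq_range`). THEOREMS ONLY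
(no definition, no instance, no notation, no named fact; D-0026 net debt 0).

## Sources, verbatim

* B. Moonen, Yu. G. Zarhin, *Hodge classes and Tate classes on simple abelian fourfolds*, Math. Ann. **315** (1999)
  (held `paper:arxiv-math_9901113`), §1, p0002 L138–L141: "For `n ≥ 1` we can identify `Hg(Xⁿ)` with `Hg(X)`, acting
  diagonally on `V_{Xⁿ} = (V_X)ⁿ`. More generally, if `n₁, …, n_r ∈ ℤ_{≥1}` then we can identify
  `Hg(X₁^{n₁} × ⋯ × X_r^{n_r})` with `Hg(X₁ × ⋯ × X_r)`."; §3 Theorem (Hazama) (2), p0006 L74–L78: "Suppose `X₁` has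
  no factors of Type IV and `X₂` is of CM-type. Then `X₁ × X₂` again satisfies (D) and
  `Hg(X₁ × X₂) = Hg(X₁) × Hg(X₂)`."; §3 Corollary, p0007 L80–L85.
* H. Imai, *On the Hodge groups of some abelian varieties*, Kōdai Math. Sem. Rep. **27** (1976) 367–372, §3 Remarks
  (p. 370 L23–L38): "If `E₁` and `E₂` are isogenous elliptic curves, the Hodge group of `E₁ × E₂` is obtained as:
  `Hg(E₁ × E₂) = {(x, λxλ⁻¹) | x ∈ Hg(E₁)}` […] For the product of elliptic curves (isogenous or not), its Hodge
  group can be obtained as follows: Let `E_i^{(j)}` (`i = 1, …, n`, `j = 1, …, m_i`) be elliptic curves such that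
  `E_i^{(j)}`, `E_i^{(j')}` are isogenous and `E_i`, `E_{i'}` (`i ≠ i'`) are non-isogenous. Then
  `Hg(∏_{i,j} E_i^{(j)}) = ∏_i Δ_{m_i}(Hg(E_i))`, where `Δ_m(H) =` the diagonal subgroup of `H^m`."; §2 Proposition,
  third case (p. 370 L11–L15).
* B. B. Gordon, *A survey of the Hodge conjecture for abelian varieties* (held `paper:arxiv-alg-geom_9709030`), §3
  Theorem and its proof (p0014 L25–L37: "mapping surjectively onto each factor […] onto each pair of factors, it is
  the entire product"), 2.15 Lemma (p0012 L77–L97: "`Lf(A) ≃ Lf(B₁) × ⋯ × Lf(B_r)`"), 7.5 Theorem (b) (p0020 L118–L123).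
* B. Moonen, Yu. G. Zarhin, loc. cit., §1 p0004 L71–L78 (Hazama–Murty: "`Hg(X) = Sp_D(V, φ)` ⟺ (`X` has no factors of
  type III and `𝒟•(Xⁿ) = ℬ•(Xⁿ)` for all `n`)"), §3 (1) p0006 L53–L57, (3.1).
* J. S. Milne, *Lefschetz classes on abelian varieties*, Duke Math. J. **96** (1999), §1 pp. 642–643, §4 Prop. 4.8.
* H. Lange, *Abelian Varieties over the Complex Numbers* (2023), §7.2.4 Exercises (4), (5), §7.2.2 Prop. 7.2.5.

## What is proved (`E_j = ℂ/Φ_j(ℤ²)`, `End_ℚ(E_j) = ℚ`, `Hom_ℚ(E_i, E_j) = 0` for `i ≠ j`; a colouring `c : Fin K → Fin m`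
onto; `Y = E₂/Φ₂(ℤ^{ι₂})` with commutative `Hg(Y)(ℂ)`; `X = E_{c(1)} × ⋯ × E_{c(K)} × Y`; `Δ_c(B) = diag_k B_{c(k)}`)

* §1 **EQUAL FACTORS HAVE EQUAL BLOCKS** (any homogeneous family `(X_k)_k` and any `Y`): the identification
  `X_l = X_k` of two equal factors is the endomorphism `((e_{kl} ⊗ 1) 0; 0 0) ∈ End_ℚ((∏_k X_k) × Y)`
  (`fromBlocks_blockSingle_one_mem_endAlgRat_pi_prod`), and `Hg(ℂ)` centralises it: every
  `((diag_k B_k) 0; 0 s) ∈ Hg((∏_k X_k) × Y)(ℂ)` has `B_k = B_l` (`apply_eq_apply_of_blockDiagC_piBlockDiagSLC_mem_hodgeGroupC_pi_prod`;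
  the `Y`-free form `apply_eq_apply_of_piBlockDiagSLC_mem_hodgeGroupC_pi`) — Imai's "`(x, λxλ⁻¹)`" with `λ = id`.
* §2 **THE SEMISIMPLE PART `Δ_c(SL₂(ℂ)^m) × 1 ≤ Hg(X)(ℂ)`** (`blockDiagC_piBlockDiagSLC_mulSingle_comp_mem_hodgeGroupC_pi_prod`,
  `blockDiagC_piBlockDiagSLC_comp_one_mem_hodgeGroupC_pi_prod`): Ribet's lemma with the commutative extra factor for the
  REPRESENTATIVE projection `(B, s) ↦ ((B_{r(t)})_t, s)` of the preimage of `Hg(X)(ℂ)` in `SL₂(ℂ)^K × SL(V_Y, ℂ)` (`r` a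
  section of `c`), whose single and pair projections are onto by the prequels, and whose fibres are pinned down by §1;
  the slice `1 × Hg(Y)(ℂ) ≤ Hg(X)(ℂ)` (`blockDiagC_one_mem_hodgeGroupC_pi_comp_prod`).
* §3 **THE THEOREM `Hg(E_{c(1)} × ⋯ × E_{c(K)} × Y)(ℂ) = Δ_c(SL₂(ℂ)^m) × Hg(Y)(ℂ)`** on elements
  (`mem_hodgeGroupC_pi_comp_prod_iff_of_forall_endAlgRat_eq_bot`) and on REAL points
  (`mem_hodgeGroup_pi_comp_prod_iff_of_forall_endAlgRat_eq_bot`: `M ∈ Hg(X)(ℝ) ⟺ M = ((diag_k A_{c(k)}) 0; 0 N)`,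
  `A ∈ SL₂(ℝ)^m` arbitrary, `N ∈ Hg(Y)(ℝ)`); `MT(X)(ℂ)` (`mem_mumfordTateGroupC_pi_comp_prod_iff_of_forall_endAlgRat_eq_bot`);
  g36-#1 is `c = id`.
* §4 **IMAI'S §3 REMARKS FOR THE CURVES WITHOUT COMPLEX MULTIPLICATION: `Hg(E_{c(1)} × ⋯ × E_{c(K)})(ℂ) = Δ_c(SL₂(ℂ)^m)`**,
  `Hg(E_{c(1)} × ⋯ × E_{c(K)})(ℝ) = Δ_c(SL₂(ℝ)^m)` (`mem_hodgeGroupC_pi_comp_iff_of_forall_endAlgRat_eq_bot`,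
  `mem_hodgeGroup_pi_comp_iff_of_forall_endAlgRat_eq_bot`; via the auxiliary CM factor `E_i`), and the `E_τ` wordings
  (`mem_hodgeGroup_pi_ellipticPeriod_comp_prod_iff`, `mem_hodgeGroup_pi_ellipticPeriod_comp_iff`).
* §5 **THE PRODUCT FORMULA `Hg(X) = Hg(∏_k E_{c(k)}) × Hg(Y)`** on real and complex points
  (`hodgeGroup_pi_comp_prod_eq_map_prod_of_forall_endAlgRat_eq_bot`, `hodgeGroupC_…`), hence `Hom_ℚ(∏_k E_{c(k)}, Y) = 0 =
  Hom_ℚ(Y, ∏_k E_{c(k)})` (`homRat_pi_comp_eq_bot_…`, `homRat_pi_comp_swap_eq_bot_…`), **`P_X = P_{∏_k E_{c(k)}} · P_Y`**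
  (`hodgePoincare_pi_comp_prod_eq_mul_…`, the Künneth count `finrank_hodgeClasses_pi_comp_prod_eq_sum_…`) and **THE `D = B`
  TRANSFER `D = B` on `Y` ⟹ `D = B` on `X`** (`divisorClasses_pi_comp_prod_eq_hodgeClasses_…`,
  `forall_divisorClasses_pi_comp_prod_eq_hodgeClasses_…`; `D = B` on `∏_k E_{c(k)}` is Tate).
* §6 **HODGE = LEFSCHETZ: `Lf(∏_k E_{c(k)}) = Hg(∏_k E_{c(k)}) = Δ_c(SL₂(ℝ)^m)`** for the product and for every polarisation
  (`lefschetzGroup_pi_comp_piForm_eq_hodgeGroup_…`, `IsRiemannForm.lefschetzGroup_pi_comp_eq_hodgeGroup_…`), **THE LEFSCHETZ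
  PRODUCT FORMULA `Lf(X, η) = Hg(∏_k E_{c(k)}) × Lf(Y, ω₂)`** (`IsRiemannForm.lefschetzGroup_pi_comp_prod_eq_…`), **THE TRANSFER
  `Hg(Y) = Lf(Y) ⟹ Hg(X) = Lf(X, η)`** (`IsRiemannForm.hodgeGroup_pi_comp_prod_eq_lefschetzGroup_…`) and **THE CRITERION
  `Hg(X) = Lf(X, η) ⟺ Hg(Y) = Lf(Y, η₂)`** (`IsRiemannForm.hodgeGroup_pi_comp_prod_eq_lefschetzGroup_iff_…`).
* §7 `E_τ` wordings (`IsRiemannForm.hodgeGroup_pi_ellipticPeriod_comp_prod_eq_lefschetzGroup`,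
  `divisorClasses_pi_ellipticPeriod_comp_prod_eq_hodgeClasses`) and **THE LOCUS `Y = ∏ₖ X_k`, UNCONDITIONALLY: `Hg = Lf` for
  every polarisation and `D = B` in every codimension on `E_{c(1)} × ⋯ × E_{c(K)} × ∏ₖ X_k`**
  (`IsRiemannForm.hodgeGroup_pi_comp_prod_sigmaPiPeriod_eq_lefschetzGroup`, `divisorClasses_pi_comp_prod_sigmaPiPeriod_eq_hodgeClasses`)
  — every product of elliptic curves in which the curves WITHOUT complex multiplication are pairwise non-isogenous or
  EQUAL, times CM blocks of any dimension on the locus.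

Faithfulness notes. (i) Moonen–Zarhin's identification `Hg(X₁^{n₁} × ⋯ × X_r^{n_r}) = Hg(X₁ × ⋯ × X_r)` is printed for
arbitrary abelian varieties; formalised here is the case `X_j = E_j` one-dimensional without complex multiplication and
pairwise `Hom_ℚ = 0`, times a torus `Y` with commutative `Hg(Y)(ℂ)` (the tree's `hodgeGroup_pi_eq_map_twistDiagSL` is the
general statement for homogeneous families WITHOUT the extra factor `Y`, on real points). (ii) Powers are taken
literally (`E_{c(k)} = E_{c(l)}` as period maps when `c(k) = c(l)`); isogenous-but-different copies are the twisted
diagonals of `ComplexTorusHodgeGroupPiIsogenousFactors`, not treated here. -- TODO(general form): isogenous copies.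

## References

* [MoonenZarhin1999LowDim] B. Moonen, Yu. G. Zarhin, Math. Ann. 315 (1999), §1 (p0002 L138–L141), §3 Theorem (2), §3 Corollary.
* [Imai1976HodgeGroups] H. Imai, Kōdai Math. Sem. Rep. 27 (1976), §2 Proposition (third case), §3 Remarks (p. 370).
* [Gordon1997] B. B. Gordon (1999), §3 Theorem and its proof, §2.16 Proposition, 2.15 Lemma, 7.5 Theorem (b).
* [Milne1999LefschetzClasses] J. S. Milne, Duke Math. J. 96 (1999), §1, §4 Prop. 4.8.
* [Lange2023AbelianVarietiesComplex] H. Lange (2023), §7.2.2 Prop. 7.2.5, §7.2.1 Remark 7.2.2, §7.2.4 Exercises (4), (5).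
* [vanGeemen1994HodgeAV] B. van Geemen (1994), §4 Thm. 4.3 (Tate).
-/

noncomputable section

open scoped Real MatrixGroups
open Complex Module Matrix Function
open Finset.HasAntidiagonal (antidiagonal)

namespace Literature.Geometry.Kaehler

namespace ComplexTorus

/-! ## §1 Equal factors have equal blocks -/

section EqualFactors

variable {K : ℕ} {ι : Type*} [Fintype ι] [DecidableEq ι] {E : Type*} [NormedAddCommGroup E] [NormedSpace ℂ E]
  (Θ : Fin K → ((ι → ℝ) ≃L[ℝ] E)) {ι₂ : Type*} [Fintype ι₂] [DecidableEq ι₂]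
  {E₂ : Type*} [NormedAddCommGroup E₂] [NormedSpace ℂ E₂] (Φ₂ : (ι₂ → ℝ) ≃L[ℝ] E₂)

/-- `diag(B)` commutes with `e_{kl} ⊗ 1` only if `B_k = B_l`: `diag(B) (e_{kl} ⊗ 1) = e_{kl} ⊗ B_k` and
`(e_{kl} ⊗ 1) diag(B) = e_{kl} ⊗ B_l`. [folklore] -/
private theorem apply_eq_apply_of_piBlockDiag_mul_blockSingle_one {R : Type*} [Semiring R] {B : Fin K → Matrix ι ι R}
    {k l : Fin K} (h : piBlockDiag B * blockSingle k l 1 = blockSingle k l 1 * piBlockDiag B) : B k = B l := by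
  have h11 := congrArg (fun N ↦ piBlock N k l) h
  simpa only [piBlock_piBlockDiag_mul, piBlock_mul_piBlockDiag, piBlock_blockSingle, and_self, if_true,
    Matrix.mul_one, Matrix.one_mul] using h11

/-- **The identification `X_l → X_k` of two EQUAL factors is an endomorphism of `∏_k X_k`**: the one-block matrix
`e_{kl} ⊗ 1 ∈ End_ℚ(∏_k X_k)` when `X_k = X_l` (the identity is a homomorphism `X_l → X_k`).
[cite: Lange2023AbelianVarietiesComplex, §1.1.2 (p. 20, `Hom_ℚ`)] [cite: Imai1976HodgeGroups, §3 Remarks (p. 370 L23–L26: "`λ : E₁ → E₂` … viewed as a map `V₁ → V₂`")] -/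
theorem blockSingle_one_mem_endAlgRat_pi {k l : Fin K} (hkl : Θ k = Θ l) :
    blockSingle k l (1 : Matrix ι ι ℚ) ∈ endAlgRat (piPeriod Θ) := by
  refine blockSingle_mem_endAlgRat_pi Θ ?_
  rw [hkl, mem_homRat_self_iff]
  exact Subalgebra.one_mem _

/-- **… and of `(∏_k X_k) × Y`**: `((e_{kl} ⊗ 1) 0; 0 0) ∈ End_ℚ((∏_k X_k) × Y)` when `X_k = X_l`.
[cite: Lange2023AbelianVarietiesComplex, §2.4.4 Cor. 2.4.26 (proof) and §1.1.2 (p. 20)] -/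
theorem fromBlocks_blockSingle_one_mem_endAlgRat_pi_prod {k l : Fin K} (hkl : Θ k = Θ l) :
    Matrix.fromBlocks (blockSingle k l (1 : Matrix ι ι ℚ)) 0 0 (0 : Matrix ι₂ ι₂ ℚ) ∈
      endAlgRat (prodPeriod (piPeriod Θ) Φ₂) :=
  (fromBlocks_mem_endAlgRat_prod_iff (piPeriod Θ) Φ₂).2
    ⟨blockSingle_one_mem_endAlgRat_pi Θ hkl, Submodule.zero_mem _, Submodule.zero_mem _, Subalgebra.zero_mem _⟩

/-- **EQUAL FACTORS HAVE EQUAL BLOCKS, `Y`-free form**: if `X_k = X_l` then every `diag_k B_k ∈ Hg(∏_k X_k)(ℂ)` has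
`B_k = B_l` — `Hg(ℂ)` centralises `End_ℚ ∋ e_{kl} ⊗ 1` (Prop. 7.2.5 on complex points), and
`(diag B)(e_{kl} ⊗ 1) = e_{kl} ⊗ B_k`, `(e_{kl} ⊗ 1)(diag B) = e_{kl} ⊗ B_l`: Imai's "`Hg(E₁ × E₂) = {(x, λxλ⁻¹)}`" with
`λ = id`, Moonen–Zarhin's "`Hg(Xⁿ) = Hg(X)`, acting diagonally". [cite: Imai1976HodgeGroups, §3 Remarks (p. 370 L23–L30)]
[cite: MoonenZarhin1999LowDim, §1 (p0002 L138–L141)] [cite: Lange2023AbelianVarietiesComplex, §7.2.2 Prop. 7.2.5] -/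
theorem apply_eq_apply_of_piBlockDiagSLC_mem_hodgeGroupC_pi {k l : Fin K} (hkl : Θ k = Θ l)
    {B : Fin K → SpecialLinearGroup ι ℂ} (h : piBlockDiagSLC B ∈ hodgeGroupC (piPeriod Θ)) : B k = B l := by
  have hc := (mem_hodgeGroupCCommutant_iff _).1
    (map_mem_hodgeGroupCCommutant_of_mem_endAlgRat _ (blockSingle_one_mem_endAlgRat_pi Θ hkl)) _ h
  rw [blockSingle_map _ _ _ (map_zero _), Matrix.map_one _ (map_zero _) (map_one _), coe_piBlockDiagSLC] at hc
  exact Subtype.ext (apply_eq_apply_of_piBlockDiag_mul_blockSingle_one hc)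

/-- **EQUAL FACTORS HAVE EQUAL BLOCKS**: if `X_k = X_l` then every `((diag_k B_k) 0; 0 s) ∈ Hg((∏_k X_k) × Y)(ℂ)` has
`B_k = B_l` (`Hg(ℂ)` centralises `((e_{kl} ⊗ 1) 0; 0 0) ∈ End_ℚ`). [cite: Imai1976HodgeGroups, §3 Remarks (p. 370 L23–L30)]
[cite: MoonenZarhin1999LowDim, §1 (p0002 L138–L141)] [cite: Lange2023AbelianVarietiesComplex, §7.2.2 Prop. 7.2.5] -/
theorem apply_eq_apply_of_blockDiagC_piBlockDiagSLC_mem_hodgeGroupC_pi_prod {k l : Fin K} (hkl : Θ k = Θ l)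
    {B : Fin K → SpecialLinearGroup ι ℂ} {s : SpecialLinearGroup ι₂ ℂ}
    (h : blockDiagC (Fin K × ι) ι₂ (piBlockDiagSLC B, s) ∈ hodgeGroupC (prodPeriod (piPeriod Θ) Φ₂)) :
    B k = B l := by
  have hc := (mem_hodgeGroupCCommutant_iff _).1
    (map_mem_hodgeGroupCCommutant_of_mem_endAlgRat _ (fromBlocks_blockSingle_one_mem_endAlgRat_pi_prod Θ Φ₂ hkl)) _ h
  rw [Matrix.fromBlocks_map, blockSingle_map _ _ _ (map_zero _), Matrix.map_one _ (map_zero _) (map_one _),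
    coe_blockDiagC, coe_piBlockDiagSLC, Matrix.fromBlocks_multiply, Matrix.fromBlocks_multiply] at hc
  have h11 := (Matrix.fromBlocks_inj.1 hc).1
  simp only [Matrix.zero_mul, Matrix.mul_zero, add_zero] at h11
  exact Subtype.ext (apply_eq_apply_of_piBlockDiag_mul_blockSingle_one h11)

/-- Real points: if `X_k = X_l` then every `((diag_k A_k) 0; 0 N) ∈ Hg((∏_k X_k) × Y)(ℝ)` has `A_k = A_l`.
[cite: MoonenZarhin1999LowDim, §1 (p0002 L138–L141)] [cite: Imai1976HodgeGroups, §3 Remarks (p. 370 L23–L30)] -/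
theorem apply_eq_apply_of_blockDiag_piBlockDiagSL_mem_hodgeGroup_pi_prod {k l : Fin K} (hkl : Θ k = Θ l)
    {A : Fin K → SpecialLinearGroup ι ℝ} {N : SpecialLinearGroup ι₂ ℝ}
    (h : blockDiag (Fin K × ι) ι₂ (piBlockDiagSL A, N) ∈ hodgeGroup (prodPeriod (piPeriod Θ) Φ₂)) : A k = A l := by
  rw [← map_ofRealHom_mem_hodgeGroupC_iff, map_ofRealHom_blockDiag_piBlockDiagSL] at h
  have hkl' := apply_eq_apply_of_blockDiagC_piBlockDiagSLC_mem_hodgeGroupC_pi_prod Θ Φ₂ hkl h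
  ext i j
  have hij := congrArg (fun M : SpecialLinearGroup ι ℂ ↦ M.1 i j) hkl'
  simpa using hij

end EqualFactors

/-! ## §2 The semisimple part `Δ_c(SL₂(ℂ)^m) × 1` and the slice `1 × Hg(Y)(ℂ)` -/

section Multiplicities

variable {m K : ℕ} (Φ : Fin m → ((Fin 2 → ℝ) ≃L[ℝ] ℂ)) (c : Fin K → Fin m) {ι₂ : Type*} [Fintype ι₂] [DecidableEq ι₂]
  {E₂ : Type*} [NormedAddCommGroup E₂] [NormedSpace ℂ E₂] (Φ₂ : (ι₂ → ℝ) ≃L[ℝ] E₂)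
  (hE : ∀ j, endAlgRat (Φ j) = ⊥) (hhom : ∀ i j, i ≠ j → homRat (Φ i) (Φ j) = ⊥) (hc : Function.Surjective c)
  (hcomm : ∀ M N : SpecialLinearGroup ι₂ ℂ, M ∈ hodgeGroupC Φ₂ → N ∈ hodgeGroupC Φ₂ → M.1 * N.1 = N.1 * M.1)

/-- Colour-constancy: every `((diag_k B_k) 0; 0 s) ∈ Hg(E_{c(1)} × ⋯ × E_{c(K)} × Y)(ℂ)` has `B_k = B_l` whenever
`c(k) = c(l)`. [cite: MoonenZarhin1999LowDim, §1 (p0002 L138–L141)] [cite: Imai1976HodgeGroups, §3 Remarks (p. 370 L31–L38)] -/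
theorem apply_eq_apply_of_blockDiagC_piBlockDiagSLC_mem_hodgeGroupC_pi_comp_prod {k l : Fin K} (hkl : c k = c l)
    {B : Fin K → SL(2, ℂ)} {s : SpecialLinearGroup ι₂ ℂ}
    (h : blockDiagC (Fin K × Fin 2) ι₂ (piBlockDiagSLC B, s) ∈ hodgeGroupC (prodPeriod (piPeriod fun k ↦ Φ (c k)) Φ₂)) :
    B k = B l :=
  apply_eq_apply_of_blockDiagC_piBlockDiagSLC_mem_hodgeGroupC_pi_prod (fun k ↦ Φ (c k)) Φ₂ (congrArg Φ hkl) h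

include hE hhom hc hcomm in
/-- **The `SL₂`-slots of a colour class: `((diag_k (x if c(k) = t else 1)) 0; 0 1) ∈ Hg(E_{c(1)} × ⋯ × E_{c(K)} × Y)(ℂ)`
for every `x ∈ SL₂(ℂ)` and every colour `t`** — Ribet's lemma with a commutative extra factor (g36-#1 §1) for the
REPRESENTATIVE projection `(B, s) ↦ ((B_{r(t)})_t, s)` (`c ∘ r = id`) of the preimage of `Hg(ℂ)` in
`SL₂(ℂ)^K × SL(V_Y, ℂ)`: perfect factors, single projections onto (`exists_blockDiagC_piBlockDiagSLC_mem_hodgeGroupC_pi_prod_apply_eq`),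
pair projections onto for distinct colours (`prod_eq_top_of_subgroup`, `Hom_ℚ(E_t, E_u) = 0`), commuting `Y`-blocks;
the element of `Hg(ℂ)` over `((1, …, x, …, 1), 1)` so found has colour-constant blocks (§1), hence is the displayed
one — "mapping surjectively onto each factor […] onto each pair of factors, it is the entire product" combined with
"`Hg(X₁^{n₁} × ⋯ × X_r^{n_r}) = Hg(X₁ × ⋯ × X_r)`". [cite: MoonenZarhin1999LowDim, §1 (p0002 L138–L141) and §3 Theorem (2) (p0006 L74–L78)]
[cite: Imai1976HodgeGroups, §2 Proposition, proof of the third case (p. 370 L11–L15) and §3 Remarks (p. 370 L31–L38)]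
[cite: Gordon1997, §3 Theorem, proof (p0014 L25–L37)] -/
theorem blockDiagC_piBlockDiagSLC_mulSingle_comp_mem_hodgeGroupC_pi_prod (t : Fin m) (x : SL(2, ℂ)) :
    blockDiagC (Fin K × Fin 2) ι₂ (piBlockDiagSLC fun k ↦ (Pi.mulSingle t x : Fin m → SL(2, ℂ)) (c k), 1) ∈
      hodgeGroupC (prodPeriod (piPeriod fun k ↦ Φ (c k)) Φ₂) := by
  classical
  obtain ⟨r, hr⟩ : ∃ r : Fin m → Fin K, ∀ t, c (r t) = t := ⟨fun t ↦ (hc t).choose, fun t ↦ (hc t).choose_spec⟩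
  set emb : (Fin K → SL(2, ℂ)) × SpecialLinearGroup ι₂ ℂ →* SpecialLinearGroup ((Fin K × Fin 2) ⊕ ι₂) ℂ :=
    (blockDiagC (Fin K × Fin 2) ι₂).comp (piBlockDiagSLC.prodMap (MonoidHom.id _)) with hemb
  set G : Subgroup ((Fin K → SL(2, ℂ)) × SpecialLinearGroup ι₂ ℂ) :=
    (hodgeGroupC (prodPeriod (piPeriod fun k ↦ Φ (c k)) Φ₂)).comap emb with hG
  have memG : ∀ B s, (B, s) ∈ G ↔
      blockDiagC (Fin K × Fin 2) ι₂ (piBlockDiagSLC B, s) ∈ hodgeGroupC (prodPeriod (piPeriod fun k ↦ Φ (c k)) Φ₂) :=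
    fun B s ↦ Iff.rfl
  -- the representative projection `ρ` and `G' = ρ(G) ≤ SL₂(ℂ)^m × SL(V_Y, ℂ)`
  set ρ : (Fin K → SL(2, ℂ)) × SpecialLinearGroup ι₂ ℂ →* (Fin m → SL(2, ℂ)) × SpecialLinearGroup ι₂ ℂ :=
    { toFun := fun g ↦ (fun t ↦ g.1 (r t), g.2), map_one' := rfl, map_mul' := fun _ _ ↦ rfl } with hρ
  have ρ_apply : ∀ g : (Fin K → SL(2, ℂ)) × SpecialLinearGroup ι₂ ℂ, ρ g = (fun t ↦ g.1 (r t), g.2) := fun g ↦ rfl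
  set G' : Subgroup ((Fin m → SL(2, ℂ)) × SpecialLinearGroup ι₂ ℂ) := G.map ρ with hG'
  -- the structural facts about `G`
  have hσG : ∀ (σ : ℂ ≃+* ℂ) (g : (Fin K → SL(2, ℂ)) × SpecialLinearGroup ι₂ ℂ), g ∈ G →
      ((fun j ↦ SpecialLinearGroup.map (σ : ℂ →+* ℂ) (g.1 j)), SpecialLinearGroup.map (σ : ℂ →+* ℂ) g.2) ∈ G :=
    fun σ g hg ↦ (memG _ _).2
      ((blockDiagC_piBlockDiagSLC_map_ringEquiv_mem_hodgeGroupC_pi_prod_iff (fun k ↦ Φ (c k)) Φ₂ σ).2 ((memG _ _).1 hg))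
  have hνG : ∀ (u : ℂ) (hu : u ≠ 0), ((fun j ↦ cocharCurveSL (Φ (c j)) u hu), complexCircleSL Φ₂ u hu) ∈ G :=
    fun u hu ↦ (memG _ _).2
      (blockDiagC_piBlockDiagSLC_cocharCurveSL_mem_hodgeGroupC_pi_prod (fun k ↦ Φ (c k)) Φ₂ u hu)
  have hsnd : ∀ g ∈ G, g.2 ∈ hodgeGroupC Φ₂ := fun g hg ↦
    snd_mem_hodgeGroupC_of_blockDiagC_mem (piPeriod fun k ↦ Φ (c k)) Φ₂ ((memG _ _).1 hg)
  have hcol : ∀ g ∈ G, ∀ k, g.1 k = g.1 (r (c k)) := fun g hg k ↦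
    apply_eq_apply_of_blockDiagC_piBlockDiagSLC_mem_hodgeGroupC_pi_comp_prod Φ c Φ₂ (hr (c k)).symm
      ((memG g.1 g.2).1 hg)
  -- the hypotheses of Ribet's lemma with the commutative extra factor, for `G'` on `T = univ`
  have hperf : ∀ t ∈ (Finset.univ : Finset (Fin m)), ∀ H : Subgroup SL(2, ℂ),
      (∀ x y : SL(2, ℂ), x * y * x⁻¹ * y⁻¹ ∈ H) → H = ⊤ :=
    fun _ _ H hH ↦ SL2C.eq_top_of_forall_commutator_mem H hH
  have hone : ∀ t ∈ (Finset.univ : Finset (Fin m)), ∀ x : SL(2, ℂ), ∃ g ∈ G', g.1 t = x := fun t _ x ↦ by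
    obtain ⟨B, s, hBs, hBt⟩ := exists_blockDiagC_piBlockDiagSLC_mem_hodgeGroupC_pi_prod_apply_eq (fun k ↦ Φ (c k)) Φ₂
      (t := r t) (by rw [hr]; exact hE t) x
    exact ⟨ρ (B, s), Subgroup.mem_map_of_mem ρ ((memG _ _).2 hBs), hBt⟩
  have htwo : ∀ t ∈ (Finset.univ : Finset (Fin m)), ∀ u ∈ (Finset.univ : Finset (Fin m)), t ≠ u →
      ∀ (x : SL(2, ℂ)) (y : SL(2, ℂ)), ∃ g ∈ G', g.1 t = x ∧ g.1 u = y := by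
    intro t _ u _ htu x y
    set π₂ : (Fin K → SL(2, ℂ)) × SpecialLinearGroup ι₂ ℂ →* SL(2, ℂ) × SL(2, ℂ) :=
      ((Pi.evalMonoidHom _ (r t)).prod (Pi.evalMonoidHom _ (r u))).comp (MonoidHom.fst _ _) with hπ₂
    have π₂_apply : ∀ g : (Fin K → SL(2, ℂ)) × SpecialLinearGroup ι₂ ℂ, π₂ g = (g.1 (r t), g.1 (r u)) := fun g ↦ rfl
    have hctu : c (r t) ≠ c (r u) := by rw [hr, hr]; exact htu
    have hI := prod_eq_top_of_subgroup (Φ (c (r t))) (Φ (c (r u))) (G.map π₂)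
      (fun u' hu' ↦ Subgroup.mem_map.2 ⟨_, hνG u' hu', rfl⟩)
      (fun σ x' y' hxy ↦ by
        obtain ⟨g, hg, hgxy⟩ := Subgroup.mem_map.1 hxy
        refine Subgroup.mem_map.2 ⟨_, hσG σ g hg, ?_⟩
        rw [π₂_apply] at hgxy ⊢
        have h1 : g.1 (r t) = x' := congrArg Prod.fst hgxy
        have h2 : g.1 (r u) = y' := congrArg Prod.snd hgxy
        rw [← h1, ← h2]) (hE _) (hE _) (hhom _ _ hctu)
    obtain ⟨g, hg, hgxy⟩ := Subgroup.mem_map.1 (hI ▸ Subgroup.mem_top (x, y) : (x, y) ∈ G.map π₂)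
    rw [π₂_apply] at hgxy
    exact ⟨ρ g, Subgroup.mem_map_of_mem ρ hg, congrArg Prod.fst hgxy, congrArg Prod.snd hgxy⟩
  have hcomm' : ∀ k ∉ (Finset.univ : Finset (Fin m)), ∀ g ∈ G', ∀ h ∈ G', g.1 k * h.1 k = h.1 k * g.1 k :=
    fun k hk ↦ absurd (Finset.mem_univ k) hk
  have hC : ∀ g ∈ G', ∀ h ∈ G', g.2 * h.2 = h.2 * g.2 := fun g' hg' h' hh' ↦ by
    obtain ⟨g, hg, rfl⟩ := Subgroup.mem_map.1 hg'
    obtain ⟨h, hh, rfl⟩ := Subgroup.mem_map.1 hh'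
    exact Subtype.ext (hcomm _ _ (hsnd g hg) (hsnd h hh))
  -- Ribet: `(mulSingle t x, 1) ∈ G'`; its preimage in `G` has colour-constant blocks
  obtain ⟨g, hg, hρg⟩ := Subgroup.mem_map.1
    (inl_mulSingle_mem_of_pairwise Finset.univ hperf hone htwo hcomm' hC (Finset.mem_univ t) x)
  have h1 : g.1 = fun k ↦ (Pi.mulSingle t x : Fin m → SL(2, ℂ)) (c k) := funext fun k ↦ by
    rw [hcol g hg k]
    exact congrFun (congrArg Prod.fst hρg) (c k)
  have h2 : g.2 = 1 := congrArg Prod.snd hρg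
  have hmem := (memG g.1 g.2).1 hg
  rwa [h1, h2] at hmem

include hE hhom hc hcomm in
/-- **The semisimple part `Δ_c(SL₂(ℂ)^m) × 1 ≤ Hg(E_{c(1)} × ⋯ × E_{c(K)} × Y)(ℂ)`**: `((diag_k B_{c(k)}) 0; 0 1) ∈ Hg(ℂ)`
for EVERY `B ∈ SL₂(ℂ)^m` ("`∏_i Δ_{m_i}(Hg(E_i))`" for the curves without complex multiplication).
[cite: Imai1976HodgeGroups, §3 Remarks (p. 370 L31–L38) and §2 Proposition, proof of the third case (p. 370 L11–L15)]
[cite: MoonenZarhin1999LowDim, §1 (p0002 L138–L141) and §3 Theorem (2) (p0006 L74–L78)] -/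
theorem blockDiagC_piBlockDiagSLC_comp_one_mem_hodgeGroupC_pi_prod (B : Fin m → SL(2, ℂ)) :
    blockDiagC (Fin K × Fin 2) ι₂ (piBlockDiagSLC fun k ↦ B (c k), 1) ∈
      hodgeGroupC (prodPeriod (piPeriod fun k ↦ Φ (c k)) Φ₂) := by
  set θ : (Fin m → SL(2, ℂ)) →* (Fin K → SL(2, ℂ)) :=
    { toFun := fun B k ↦ B (c k), map_one' := rfl, map_mul' := fun _ _ ↦ rfl } with hθ
  have h : B ∈ (hodgeGroupC (prodPeriod (piPeriod fun k ↦ Φ (c k)) Φ₂)).comap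
      ((blockDiagC (Fin K × Fin 2) ι₂).comp
        ((MonoidHom.inl _ (SpecialLinearGroup ι₂ ℂ)).comp (piBlockDiagSLC.comp θ))) := by
    refine Subgroup.pi_mem_of_mulSingle_mem B fun t ↦ ?_
    exact blockDiagC_piBlockDiagSLC_mulSingle_comp_mem_hodgeGroupC_pi_prod Φ c Φ₂ hE hhom hc hcomm t (B t)
  exact h

include hE hhom hc hcomm in
/-- **The slice `1 × Hg(Y)(ℂ) ≤ Hg(E_{c(1)} × ⋯ × E_{c(K)} × Y)(ℂ)`**: `(1 0; 0 t) ∈ Hg(ℂ)` for every `t ∈ Hg(Y)(ℂ)`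
(the tree's slice theorem `blockDiagC_inr_mem_hodgeGroupC_prod`, fed by the circles `((diag_k h_{c(k)}(e^{iθ})) ⊗ 1, 1)`
of the semisimple part). [cite: Imai1976HodgeGroups, §1 (p. 367) and §2 Proposition, proof of the third case (p. 370 L11–L15)]
[cite: Gordon1997, §3 Theorem, proof (p0014 L33–L37)] -/
theorem blockDiagC_one_mem_hodgeGroupC_pi_comp_prod {t : SpecialLinearGroup ι₂ ℂ} (ht : t ∈ hodgeGroupC Φ₂) :
    blockDiagC (Fin K × Fin 2) ι₂ (1, t) ∈ hodgeGroupC (prodPeriod (piPeriod fun k ↦ Φ (c k)) Φ₂) := by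
  refine blockDiagC_inr_mem_hodgeGroupC_prod (piPeriod fun k ↦ Φ (c k)) Φ₂ (fun θ ↦ ?_) ht
  rw [hodgeCircleSL_piPeriod, map_ofRealHom_piBlockDiagSL]
  exact blockDiagC_piBlockDiagSLC_comp_one_mem_hodgeGroupC_pi_prod Φ c Φ₂ hE hhom hc hcomm
    fun j ↦ SpecialLinearGroup.map Complex.ofRealHom (hodgeCircleSL (Φ j) θ)

/-! ## §3 The theorem, on complex and on real points -/

include hE hhom hc hcomm in
/-- **THE THEOREM (Moonen–Zarhin §1 inside Hazama (2); Imai's third case with multiplicities), complex points: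
`M ∈ Hg(E_{c(1)} × ⋯ × E_{c(K)} × Y)(ℂ) ⟺ M = ((diag_k B_{c(k)}) 0; 0 t)` with `B ∈ SL₂(ℂ)^m` ARBITRARY and
`t ∈ Hg(Y)(ℂ)`** — for pairwise `Hom_ℚ = 0` curves `E_j` without complex multiplication, a colouring `c` onto, and ANY
complex torus `Y` with commutative `Hg(Y)(ℂ)`; g36-#1's `mem_hodgeGroupC_pi_prod_iff_of_forall_endAlgRat_eq_bot` is
`c = id`. `⟹`: the carrier lemma and colour-constancy (§1); `⟸`: the semisimple part times the slice (§2).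
[cite: MoonenZarhin1999LowDim, §1 (p0002 L138–L141) and §3 Theorem (2) (p0006 L74–L78)]
[cite: Imai1976HodgeGroups, §3 Remarks (p. 370 L31–L38) and §2 Proposition, third case (p. 370 L11–L15)] -/
theorem mem_hodgeGroupC_pi_comp_prod_iff_of_forall_endAlgRat_eq_bot {M : SpecialLinearGroup ((Fin K × Fin 2) ⊕ ι₂) ℂ} :
    M ∈ hodgeGroupC (prodPeriod (piPeriod fun k ↦ Φ (c k)) Φ₂) ↔ ∃ (B : Fin m → SL(2, ℂ)) (t : SpecialLinearGroup ι₂ ℂ),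
      t ∈ hodgeGroupC Φ₂ ∧ M = blockDiagC (Fin K × Fin 2) ι₂ (piBlockDiagSLC fun k ↦ B (c k), t) := by
  classical
  obtain ⟨r, hr⟩ : ∃ r : Fin m → Fin K, ∀ t, c (r t) = t := ⟨fun t ↦ (hc t).choose, fun t ↦ (hc t).choose_spec⟩
  constructor
  · intro hM
    obtain ⟨B, t, -, ht, rfl⟩ :=
      exists_eq_blockDiagC_piBlockDiagSLC_of_mem_hodgeGroupC_pi_prod (fun k ↦ Φ (c k)) Φ₂ hM
    refine ⟨fun j ↦ B (r j), t, ht, ?_⟩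
    have hB : B = fun k ↦ B (r (c k)) := funext fun k ↦
      apply_eq_apply_of_blockDiagC_piBlockDiagSLC_mem_hodgeGroupC_pi_comp_prod Φ c Φ₂ (hr (c k)).symm hM
    exact congrArg (fun B' ↦ blockDiagC (Fin K × Fin 2) ι₂ (piBlockDiagSLC B', t)) hB
  · rintro ⟨B, t, ht, rfl⟩
    have h := mul_mem (blockDiagC_piBlockDiagSLC_comp_one_mem_hodgeGroupC_pi_prod Φ c Φ₂ hE hhom hc hcomm B)
      (blockDiagC_one_mem_hodgeGroupC_pi_comp_prod Φ c Φ₂ hE hhom hc hcomm ht)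
    rwa [← map_mul, Prod.mk_mul_mk, mul_one, one_mul] at h

include hE hhom hc hcomm in
/-- **REAL POINTS: `M ∈ Hg(E_{c(1)} × ⋯ × E_{c(K)} × Y)(ℝ) ⟺ M = ((diag_k A_{c(k)}) 0; 0 N)` with `A ∈ SL₂(ℝ)^m`
ARBITRARY and `N ∈ Hg(Y)(ℝ)`** (`Hg(X)(ℝ) = Δ_c(SL₂(ℝ)^m) × Hg(Y)(ℝ)`, by descent `Hg(X)(ℝ) = Hg(X)(ℂ) ∩ SL(V_ℝ)`).
[cite: MoonenZarhin1999LowDim, §1 (p0002 L138–L141) and §3 Theorem (2) (p0006 L74–L78)]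
[cite: Imai1976HodgeGroups, §3 Remarks (p. 370 L31–L38)] -/
theorem mem_hodgeGroup_pi_comp_prod_iff_of_forall_endAlgRat_eq_bot {M : SpecialLinearGroup ((Fin K × Fin 2) ⊕ ι₂) ℝ} :
    M ∈ hodgeGroup (prodPeriod (piPeriod fun k ↦ Φ (c k)) Φ₂) ↔ ∃ (A : Fin m → SL(2, ℝ)) (N : SpecialLinearGroup ι₂ ℝ),
      N ∈ hodgeGroup Φ₂ ∧ M = blockDiag (Fin K × Fin 2) ι₂ (piBlockDiagSL fun k ↦ A (c k), N) := by
  classical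
  obtain ⟨r, hr⟩ : ∃ r : Fin m → Fin K, ∀ t, c (r t) = t := ⟨fun t ↦ (hc t).choose, fun t ↦ (hc t).choose_spec⟩
  constructor
  · intro hM
    obtain ⟨A, N, -, hN, rfl⟩ := exists_eq_blockDiag_piBlockDiagSL_of_mem_hodgeGroup_pi_prod (fun k ↦ Φ (c k)) Φ₂ hM
    refine ⟨fun j ↦ A (r j), N, hN, ?_⟩
    have hA : A = fun k ↦ A (r (c k)) := funext fun k ↦
      apply_eq_apply_of_blockDiag_piBlockDiagSL_mem_hodgeGroup_pi_prod (fun k ↦ Φ (c k)) Φ₂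
        (congrArg Φ (hr (c k)).symm) hM
    exact congrArg (fun A' ↦ blockDiag (Fin K × Fin 2) ι₂ (piBlockDiagSL A', N)) hA
  · rintro ⟨A, N, hN, rfl⟩
    rw [← map_ofRealHom_mem_hodgeGroupC_iff, map_ofRealHom_blockDiag_piBlockDiagSL,
      mem_hodgeGroupC_pi_comp_prod_iff_of_forall_endAlgRat_eq_bot Φ c Φ₂ hE hhom hc hcomm]
    exact ⟨fun j ↦ SpecialLinearGroup.map Complex.ofRealHom (A j), _, (map_ofRealHom_mem_hodgeGroupC_iff Φ₂).2 hN, rfl⟩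

include hE hhom hc hcomm in
/-- **`MT(E_{c(1)} × ⋯ × E_{c(K)} × Y)(ℂ) = ℂ^× · (Δ_c(SL₂(ℂ)^m) × Hg(Y)(ℂ))` on elements** (`MT(X)(ℂ) = 𝔾_m · Hg(X)(ℂ)`).
[cite: Lange2023AbelianVarietiesComplex, §7.2.1 Remark 7.2.2 (2)] [cite: MoonenZarhin1999LowDim, §1 (p0002 L138–L141) and §3 Theorem (2)] -/
theorem mem_mumfordTateGroupC_pi_comp_prod_iff_of_forall_endAlgRat_eq_bot {g : GL ((Fin K × Fin 2) ⊕ ι₂) ℂ} :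
    g ∈ mumfordTateGroupC (prodPeriod (piPeriod fun k ↦ Φ (c k)) Φ₂) ↔
      ∃ (α : ℂˣ) (B : Fin m → SL(2, ℂ)) (t : SpecialLinearGroup ι₂ ℂ), t ∈ hodgeGroupC Φ₂ ∧
        g = Matrix.GeneralLinearGroup.scalar ((Fin K × Fin 2) ⊕ ι₂) α *
          Matrix.SpecialLinearGroup.toGL (blockDiagC (Fin K × Fin 2) ι₂ (piBlockDiagSLC fun k ↦ B (c k), t)) := by
  rw [mem_mumfordTateGroupC_iff_exists_eq_scalar_mul]
  constructor
  · rintro ⟨α, N, hN, rfl⟩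
    obtain ⟨B, t, ht, rfl⟩ := (mem_hodgeGroupC_pi_comp_prod_iff_of_forall_endAlgRat_eq_bot Φ c Φ₂ hE hhom hc hcomm).1 hN
    exact ⟨α, B, t, ht, rfl⟩
  · rintro ⟨α, B, t, ht, rfl⟩
    exact ⟨α, _, (mem_hodgeGroupC_pi_comp_prod_iff_of_forall_endAlgRat_eq_bot Φ c Φ₂ hE hhom hc hcomm).2
      ⟨B, t, ht, rfl⟩, rfl⟩

end Multiplicities

/-! ## §4 Imai's §3 Remarks for the curves without complex multiplication: `Hg(E_{c(1)} × ⋯ × E_{c(K)}) = Δ_c(SL₂^m)` -/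

section Curves

variable {m K : ℕ} (Φ : Fin m → ((Fin 2 → ℝ) ≃L[ℝ] ℂ)) (c : Fin K → Fin m)
  (hE : ∀ j, endAlgRat (Φ j) = ⊥) (hhom : ∀ i j, i ≠ j → homRat (Φ i) (Φ j) = ⊥) (hc : Function.Surjective c)

/-- The auxiliary factor `E_i = ℂ/(ℤi + ℤ)` has complex multiplication, so its `Hg(ℂ)` is commutative.
[cite: Imai1976HodgeGroups, §2 (p. 368 L5–L7)] -/
private theorem hodgeGroupC_ellipticPeriod_I_comm (hI : Complex.I.im ≠ 0) {M N : SL(2, ℂ)}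
    (hM : M ∈ hodgeGroupC (ellipticPeriod hI)) (hN : N ∈ hodgeGroupC (ellipticPeriod hI)) :
    M.1 * N.1 = N.1 * M.1 :=
  hodgeGroupC_ellipticPeriod_mul_comm_of_ne_bot hI
    ((ellipticEnd_ne_bot_iff hI).2 ⟨0, 1, by push_cast; rw [zero_mul, add_zero, I_sq, neg_add_cancel]⟩) hM hN

include hE hhom hc in
/-- **`Hg(E_{c(1)} × ⋯ × E_{c(K)})(ℂ) = Δ_c(SL₂(ℂ)^m)` on elements: `M ∈ Hg(ℂ) ⟺ M = diag_k B_{c(k)}`, `B ∈ SL₂(ℂ)^m`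
ARBITRARY** — Imai's §3 Remarks "`Hg(∏_{i,j} E_i^{(j)}) = ∏_i Δ_{m_i}(Hg(E_i))`" for the classes WITHOUT complex
multiplication (`Hg(E_i) = SL₂`), on complex points, for abstract one-dimensional tori (`⟸` by the first projection
of §2's semisimple part with the auxiliary CM factor `E_i`; `⟹` by §1).
[cite: Imai1976HodgeGroups, §3 Remarks (p. 370 L31–L38) and §2 Proposition (p. 368 L11–L13)]
[cite: MoonenZarhin1999LowDim, §1 (p0002 L138–L141) and §3 Corollary (p0007 L80–L85)] -/
theorem mem_hodgeGroupC_pi_comp_iff_of_forall_endAlgRat_eq_bot {M : SpecialLinearGroup (Fin K × Fin 2) ℂ} :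
    M ∈ hodgeGroupC (piPeriod fun k ↦ Φ (c k)) ↔ ∃ B : Fin m → SL(2, ℂ), M = piBlockDiagSLC fun k ↦ B (c k) := by
  classical
  obtain ⟨r, hr⟩ : ∃ r : Fin m → Fin K, ∀ t, c (r t) = t := ⟨fun t ↦ (hc t).choose, fun t ↦ (hc t).choose_spec⟩
  constructor
  · intro hM
    obtain ⟨B, -, rfl⟩ := exists_eq_piBlockDiagSLC_of_mem_hodgeGroupC_pi (fun k ↦ Φ (c k)) hM
    refine ⟨fun j ↦ B (r j), ?_⟩
    have hB : B = fun k ↦ B (r (c k)) := funext fun k ↦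
      apply_eq_apply_of_piBlockDiagSLC_mem_hodgeGroupC_pi (fun k ↦ Φ (c k)) (congrArg Φ (hr (c k)).symm) hM
    exact congrArg piBlockDiagSLC hB
  · rintro ⟨B, rfl⟩
    -- the auxiliary CM factor `E_i`
    have hI : Complex.I.im ≠ 0 := by rw [Complex.I_im]; exact one_ne_zero
    exact fst_mem_hodgeGroupC_of_blockDiagC_mem (piPeriod fun k ↦ Φ (c k)) (ellipticPeriod hI)
      (blockDiagC_piBlockDiagSLC_comp_one_mem_hodgeGroupC_pi_prod Φ c (ellipticPeriod hI) hE hhom hc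
        (fun _ _ hM hN ↦ hodgeGroupC_ellipticPeriod_I_comm hI hM hN) B)

include hE hhom hc in
/-- **REAL POINTS: `Hg(E_{c(1)} × ⋯ × E_{c(K)})(ℝ) = Δ_c(SL₂(ℝ)^m)` on elements.**
[cite: Imai1976HodgeGroups, §3 Remarks (p. 370 L31–L38)] [cite: MoonenZarhin1999LowDim, §1 (p0002 L138–L141)] -/
theorem mem_hodgeGroup_pi_comp_iff_of_forall_endAlgRat_eq_bot {M : SpecialLinearGroup (Fin K × Fin 2) ℝ} :
    M ∈ hodgeGroup (piPeriod fun k ↦ Φ (c k)) ↔ ∃ A : Fin m → SL(2, ℝ), M = piBlockDiagSL fun k ↦ A (c k) := by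
  classical
  obtain ⟨r, hr⟩ : ∃ r : Fin m → Fin K, ∀ t, c (r t) = t := ⟨fun t ↦ (hc t).choose, fun t ↦ (hc t).choose_spec⟩
  constructor
  · intro hM
    obtain ⟨A, -, rfl⟩ := exists_eq_piBlockDiagSL_of_mem_hodgeGroup_pi (fun k ↦ Φ (c k)) hM
    refine ⟨fun j ↦ A (r j), ?_⟩
    have hM' := (map_ofRealHom_mem_hodgeGroupC_iff (piPeriod fun k ↦ Φ (c k))).2 hM
    rw [map_ofRealHom_piBlockDiagSL] at hM'
    have hA : A = fun k ↦ A (r (c k)) := funext fun k ↦ by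
      have hk := apply_eq_apply_of_piBlockDiagSLC_mem_hodgeGroupC_pi (fun k ↦ Φ (c k))
        (congrArg Φ (hr (c k)).symm) hM'
      ext i j
      have hij := congrArg (fun M : SL(2, ℂ) ↦ M.1 i j) hk
      simpa using hij
    exact congrArg piBlockDiagSL hA
  · rintro ⟨A, rfl⟩
    rw [← map_ofRealHom_mem_hodgeGroupC_iff, map_ofRealHom_piBlockDiagSL,
      mem_hodgeGroupC_pi_comp_iff_of_forall_endAlgRat_eq_bot Φ c hE hhom hc]
    exact ⟨fun j ↦ SpecialLinearGroup.map Complex.ofRealHom (A j), rfl⟩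

end Curves

/-! ## §5 The product formula `Hg(X) = Hg(∏_k E_{c(k)}) × Hg(Y)`, `Hom_ℚ = 0` both ways, and the Hodge classes -/

section ProductFormula

variable {m K : ℕ} (Φ : Fin m → ((Fin 2 → ℝ) ≃L[ℝ] ℂ)) (c : Fin K → Fin m) {ι₂ : Type*} [Fintype ι₂] [DecidableEq ι₂]
  {E₂ : Type*} [NormedAddCommGroup E₂] [NormedSpace ℂ E₂] (Φ₂ : (ι₂ → ℝ) ≃L[ℝ] E₂)
  (hE : ∀ j, endAlgRat (Φ j) = ⊥) (hhom : ∀ i j, i ≠ j → homRat (Φ i) (Φ j) = ⊥) (hc : Function.Surjective c)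
  (hcomm : ∀ M N : SpecialLinearGroup ι₂ ℂ, M ∈ hodgeGroupC Φ₂ → N ∈ hodgeGroupC Φ₂ → M.1 * N.1 = N.1 * M.1)

include hE hhom hc hcomm in
/-- **THE PRINTED PRODUCT FORMULA WITH MULTIPLICITIES: `Hg(E_{c(1)} × ⋯ × E_{c(K)} × Y) = Hg(E_{c(1)} × ⋯ × E_{c(K)}) × Hg(Y)`**
(real points, block-diagonally) — "`Hg(X₁ × X₂) = Hg(X₁) × Hg(X₂)`" for `X₁ = ∏_k E_{c(k)}` (no factor of type IV) and
`X₂ = Y` (commutative `Hg(ℂ)`). [cite: MoonenZarhin1999LowDim, §3 Theorem (2) (p0006 L74–L78) and §1 (p0002 L138–L141)]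
[cite: Imai1976HodgeGroups, §2 Proposition, third case (p. 370 L11–L15) and §3 Remarks (p. 370 L31–L38)] -/
theorem hodgeGroup_pi_comp_prod_eq_map_prod_of_forall_endAlgRat_eq_bot :
    hodgeGroup (prodPeriod (piPeriod fun k ↦ Φ (c k)) Φ₂) =
      ((hodgeGroup (piPeriod fun k ↦ Φ (c k))).prod (hodgeGroup Φ₂)).map (blockDiag (Fin K × Fin 2) ι₂) := by
  ext M
  rw [mem_hodgeGroup_pi_comp_prod_iff_of_forall_endAlgRat_eq_bot Φ c Φ₂ hE hhom hc hcomm, Subgroup.mem_map]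
  constructor
  · rintro ⟨A, N, hN, rfl⟩
    exact ⟨(piBlockDiagSL fun k ↦ A (c k), N), Subgroup.mem_prod.2
      ⟨(mem_hodgeGroup_pi_comp_iff_of_forall_endAlgRat_eq_bot Φ c hE hhom hc).2 ⟨A, rfl⟩, hN⟩, rfl⟩
  · rintro ⟨⟨P, N⟩, hPN, rfl⟩
    obtain ⟨hP, hN⟩ := Subgroup.mem_prod.1 hPN
    obtain ⟨A, rfl⟩ := (mem_hodgeGroup_pi_comp_iff_of_forall_endAlgRat_eq_bot Φ c hE hhom hc).1 hP
    exact ⟨A, N, hN, rfl⟩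

include hE hhom hc hcomm in
/-- `Hg(∏_k E_{c(k)})(ℝ) × Hg(Y)(ℝ) ≤ Hg((∏_k E_{c(k)}) × Y)(ℝ)` — the hypothesis of the tree's Künneth theorems
(`ComplexTorusHodgeClassesProductHodgeGroup` §5). [cite: MoonenZarhin1999LowDim, §3 Theorem (2) and (3.1)] -/
theorem prod_map_blockDiag_le_hodgeGroup_pi_comp_prod :
    ((hodgeGroup (piPeriod fun k ↦ Φ (c k))).prod (hodgeGroup Φ₂)).map (blockDiag (Fin K × Fin 2) ι₂) ≤
      hodgeGroup (prodPeriod (piPeriod fun k ↦ Φ (c k)) Φ₂) :=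
  (hodgeGroup_pi_comp_prod_eq_map_prod_of_forall_endAlgRat_eq_bot Φ c Φ₂ hE hhom hc hcomm).ge

include hE hhom hc hcomm in
/-- Complex points: `Hg((∏_k E_{c(k)}) × Y)(ℂ) = Hg(∏_k E_{c(k)})(ℂ) × Hg(Y)(ℂ)` (block-diagonally).
[cite: MoonenZarhin1999LowDim, §3 Theorem (2) (p0006 L74–L78) and §1 (p0002 L138–L141)] -/
theorem hodgeGroupC_pi_comp_prod_eq_map_prod_of_forall_endAlgRat_eq_bot :
    hodgeGroupC (prodPeriod (piPeriod fun k ↦ Φ (c k)) Φ₂) =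
      ((hodgeGroupC (piPeriod fun k ↦ Φ (c k))).prod (hodgeGroupC Φ₂)).map (blockDiagC (Fin K × Fin 2) ι₂) := by
  ext M
  rw [mem_hodgeGroupC_pi_comp_prod_iff_of_forall_endAlgRat_eq_bot Φ c Φ₂ hE hhom hc hcomm, Subgroup.mem_map]
  constructor
  · rintro ⟨B, t, ht, rfl⟩
    exact ⟨(piBlockDiagSLC fun k ↦ B (c k), t), Subgroup.mem_prod.2
      ⟨(mem_hodgeGroupC_pi_comp_iff_of_forall_endAlgRat_eq_bot Φ c hE hhom hc).2 ⟨B, rfl⟩, ht⟩, rfl⟩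
  · rintro ⟨⟨P, t⟩, hPt, rfl⟩
    obtain ⟨hP, ht⟩ := Subgroup.mem_prod.1 hPt
    obtain ⟨B, rfl⟩ := (mem_hodgeGroupC_pi_comp_iff_of_forall_endAlgRat_eq_bot Φ c hE hhom hc).1 hP
    exact ⟨B, t, ht, rfl⟩

include hE hhom hc hcomm in
/-- **`Hom_ℚ(E_{c(1)} × ⋯ × E_{c(K)}, Y) = 0`** (the product formula forces it). [cite: MoonenZarhin1999LowDim, §3 Theorem (2) and §3 (1) (p0006 L53–L57)]
[cite: Imai1976HodgeGroups, §3 Remarks (p. 370)] -/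
theorem homRat_pi_comp_eq_bot_of_forall_endAlgRat_eq_bot : homRat (piPeriod fun k ↦ Φ (c k)) Φ₂ = ⊥ :=
  homRat_eq_bot_of_hodgeGroup_prodPeriod_eq_map_blockDiag _ Φ₂
    (hodgeGroup_pi_comp_prod_eq_map_prod_of_forall_endAlgRat_eq_bot Φ c Φ₂ hE hhom hc hcomm)

include hE hhom hc hcomm in
/-- **`Hom_ℚ(Y, E_{c(1)} × ⋯ × E_{c(K)}) = 0`** likewise. [cite: MoonenZarhin1999LowDim, §3 Theorem (2) and §3 (1) (p0006 L53–L57)]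
[cite: Imai1976HodgeGroups, §3 Remarks (p. 370)] -/
theorem homRat_pi_comp_swap_eq_bot_of_forall_endAlgRat_eq_bot : homRat Φ₂ (piPeriod fun k ↦ Φ (c k)) = ⊥ :=
  homRat_swap_eq_bot_of_hodgeGroup_prodPeriod_eq_map_blockDiag _ Φ₂
    (hodgeGroup_pi_comp_prod_eq_map_prod_of_forall_endAlgRat_eq_bot Φ c Φ₂ hE hhom hc hcomm)

include hE hhom hc hcomm in
/-- **`P_{(∏_k E_{c(k)}) × Y}(t) = P_{∏_k E_{c(k)}}(t) · P_Y(t)`** (graded dimensions of the Hodge classes).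
[cite: Gordon1997, §3 Theorem (second bullet) and its proof (p0014 L25–L33)] [cite: MoonenZarhin1999LowDim, §3 (3.1)] -/
theorem hodgePoincare_pi_comp_prod_eq_mul_of_forall_endAlgRat_eq_bot :
    hodgePoincare (prodPeriod (piPeriod fun k ↦ Φ (c k)) Φ₂) = hodgePoincare (piPeriod fun k ↦ Φ (c k)) * hodgePoincare Φ₂ :=
  hodgePoincare_prod_eq_mul_of_prod_le_hodgeGroup _ Φ₂
    (prod_map_blockDiag_le_hodgeGroup_pi_comp_prod Φ c Φ₂ hE hhom hc hcomm)

include hE hhom hc hcomm in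
/-- **The Künneth count `dim_ℚ H^{2p}_Hodge((∏_k E_{c(k)}) × Y) = Σ_{a+b=p} dim_ℚ H^{2a}_Hodge(∏_k E_{c(k)}) · dim_ℚ H^{2b}_Hodge(Y)`.**
[cite: Gordon1997, §3 Theorem, proof (p0014 L25–L33)] [cite: MoonenZarhin1999LowDim, §3 (3.1)] -/
theorem finrank_hodgeClasses_pi_comp_prod_eq_sum_of_forall_endAlgRat_eq_bot (p : ℕ) :
    finrank ℚ (hodgeClasses (prodPeriod (piPeriod fun k ↦ Φ (c k)) Φ₂) p) =
      ∑ ab ∈ antidiagonal p,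
        finrank ℚ (hodgeClasses (piPeriod fun k ↦ Φ (c k)) ab.1) * finrank ℚ (hodgeClasses Φ₂ ab.2) :=
  finrank_hodgeClasses_prod_eq_sum_of_prod_le_hodgeGroup _ Φ₂
    (prod_map_blockDiag_le_hodgeGroup_pi_comp_prod Φ c Φ₂ hE hhom hc hcomm) p

include hE hhom hc hcomm in
/-- **`D = B` TRANSFER WITH MULTIPLICITIES: `Dᵇ = H^{2b}_Hodge` on `Y` for `b ≤ p` ⟹ `Dᵖ((∏_k E_{c(k)}) × Y) = H^{2p}_Hodge`**
("`X₁ × X₂` again satisfies (D)"; `D = B` on `∏_k E_{c(k)}` is Tate's theorem `divisorClasses_pi_eq_hodgeClasses_of_rank_one`).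
[cite: MoonenZarhin1999LowDim, §3 Theorem (2) (p0006 L74–L78), §1 (p0002 L138–L141) and (3.1)] [cite: Gordon1997, §3 Theorem (second bullet)] -/
theorem divisorClasses_pi_comp_prod_eq_hodgeClasses_of_forall_endAlgRat_eq_bot {p : ℕ}
    (hY : ∀ b ≤ p, divisorClasses Φ₂ b = hodgeClasses Φ₂ b) :
    divisorClasses (prodPeriod (piPeriod fun k ↦ Φ (c k)) Φ₂) p = hodgeClasses (prodPeriod (piPeriod fun k ↦ Φ (c k)) Φ₂) p :=
  divisorClasses_prod_eq_hodgeClasses_of_prod_le_hodgeGroup _ Φ₂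
    (prod_map_blockDiag_le_hodgeGroup_pi_comp_prod Φ c Φ₂ hE hhom hc hcomm)
    (fun a _ ↦ divisorClasses_pi_eq_hodgeClasses_of_rank_one _ a) hY

include hE hhom hc hcomm in
/-- All codimensions: **`D = B` on `Y` ⟹ `D = B` on `E_{c(1)} × ⋯ × E_{c(K)} × Y`.** [cite: MoonenZarhin1999LowDim, §3 Theorem (2) and (3.1)]
[cite: Gordon1997, §3 Theorem (second bullet)] -/
theorem forall_divisorClasses_pi_comp_prod_eq_hodgeClasses_of_forall_endAlgRat_eq_bot
    (hY : ∀ b, divisorClasses Φ₂ b = hodgeClasses Φ₂ b) (p : ℕ) :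
    divisorClasses (prodPeriod (piPeriod fun k ↦ Φ (c k)) Φ₂) p = hodgeClasses (prodPeriod (piPeriod fun k ↦ Φ (c k)) Φ₂) p :=
  divisorClasses_pi_comp_prod_eq_hodgeClasses_of_forall_endAlgRat_eq_bot Φ c Φ₂ hE hhom hc hcomm fun b _ ↦ hY b

end ProductFormula

/-! ## §6 Hodge = Lefschetz: `Lf(∏_k E_{c(k)}) = Hg(∏_k E_{c(k)})`, the transfer to `(∏_k E_{c(k)}) × Y`, the criterion -/

section Lefschetz

variable {m K : ℕ} (Φ : Fin m → ((Fin 2 → ℝ) ≃L[ℝ] ℂ)) (c : Fin K → Fin m) {ι₂ : Type*} [Fintype ι₂] [DecidableEq ι₂]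
  {E₂ : Type*} [NormedAddCommGroup E₂] [NormedSpace ℂ E₂] [FiniteDimensional ℂ E₂] (Φ₂ : (ι₂ → ℝ) ≃L[ℝ] E₂)
  (hE : ∀ j, endAlgRat (Φ j) = ⊥) (hhom : ∀ i j, i ≠ j → homRat (Φ i) (Φ j) = ⊥) (hc : Function.Surjective c)
  (hcomm : ∀ M N : SpecialLinearGroup ι₂ ℂ, M ∈ hodgeGroupC Φ₂ → N ∈ hodgeGroupC Φ₂ → M.1 * N.1 = N.1 * M.1)

include hE hhom hc in
/-- **`Lf(E_{c(1)} × ⋯ × E_{c(K)})(ℝ) = Hg(E_{c(1)} × ⋯ × E_{c(K)})(ℝ) = Δ_c(SL₂(ℝ)^m)` for the product polarisation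
`⊞_k ω_{c(k)}`**: an element of `Lf` is block diagonal (Milne's `C(∏) ⊂ ∏ C(A_i)`), and centralising the identifications
`e_{kl} ⊗ 1 ∈ End_ℚ` (`c(k) = c(l)`) makes its blocks colour-constant; `Hg ⊆ Lf` always.
[cite: Milne1999LefschetzClasses, §1 (pp. 642–643)] [cite: Gordon1997, 2.15 Lemma and 7.5 Theorem (b)]
[cite: MoonenZarhin1999LowDim, §1 (p0002 L138–L141) and §3 Corollary (p0007 L80–L85)] -/
theorem lefschetzGroup_pi_comp_piForm_eq_hodgeGroup_of_forall_endAlgRat_eq_bot {ω : Fin m → (ℂ [⋀^Fin 2]→L[ℝ] ℝ)}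
    (hω : ∀ j, IsRiemannForm (Φ j) (ω j)) :
    lefschetzGroup (piPeriod fun k ↦ Φ (c k)) (piForm fun k ↦ ω (c k)) = hodgeGroup (piPeriod fun k ↦ Φ (c k)) := by
  classical
  obtain ⟨r, hr⟩ : ∃ r : Fin m → Fin K, ∀ t, c (r t) = t := ⟨fun t ↦ (hc t).choose, fun t ↦ (hc t).choose_spec⟩
  refine le_antisymm (fun M hM ↦ ?_) (IsRiemannForm.pi fun k ↦ hω (c k)).hodgeGroup_le_lefschetzGroup
  obtain ⟨A, -, rfl⟩ := Subgroup.mem_map.1 (IsRiemannForm.lefschetzGroup_pi_le (fun k ↦ hω (c k)) hM)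
  rw [mem_hodgeGroup_pi_comp_iff_of_forall_endAlgRat_eq_bot Φ c hE hhom hc]
  refine ⟨fun j ↦ A (r j), congrArg piBlockDiagSL (funext fun k ↦ ?_)⟩
  have hk := ((mem_lefschetzGroup_iff _).1 hM).2 _
    (blockSingle_one_mem_endAlgRat_pi (fun k ↦ Φ (c k)) (k := k) (l := r (c k)) (congrArg Φ (hr (c k)).symm))
  rw [blockSingle_map _ _ _ Rat.cast_zero, Matrix.map_one _ Rat.cast_zero Rat.cast_one, coe_piBlockDiagSL] at hk
  exact Subtype.ext (apply_eq_apply_of_piBlockDiag_mul_blockSingle_one hk)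

include hE hhom hc in
/-- **`Lf(E_{c(1)} × ⋯ × E_{c(K)})(ℝ) = Hg(E_{c(1)} × ⋯ × E_{c(K)})(ℝ)` for EVERY polarisation `η`** (`Lf` does not depend
on the polarisation). [cite: Lange2023AbelianVarietiesComplex, §7.2.4 Exercise (4)(a), (c)] [cite: Gordon1997, 7.5 Theorem (b)]
[cite: MoonenZarhin1999LowDim, §3 Corollary (p0007 L80–L85: "every product of elliptic curves satisfies condition (D)")] -/
theorem IsRiemannForm.lefschetzGroup_pi_comp_eq_hodgeGroup_of_forall_endAlgRat_eq_bot {ω : Fin m → (ℂ [⋀^Fin 2]→L[ℝ] ℝ)}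
    (hω : ∀ j, IsRiemannForm (Φ j) (ω j)) {η : (Fin K → ℂ) [⋀^Fin 2]→L[ℝ] ℝ}
    (hη : IsRiemannForm (piPeriod fun k ↦ Φ (c k)) η) :
    lefschetzGroup (piPeriod fun k ↦ Φ (c k)) η = hodgeGroup (piPeriod fun k ↦ Φ (c k)) := by
  rw [hη.lefschetzGroup_eq (IsRiemannForm.pi fun k ↦ hω (c k))]
  exact lefschetzGroup_pi_comp_piForm_eq_hodgeGroup_of_forall_endAlgRat_eq_bot Φ c hE hhom hc hω

include hE hhom hc hcomm in
/-- **THE LEFSCHETZ PRODUCT FORMULA WITH MULTIPLICITIES: `Lf((∏_k E_{c(k)}) × Y, η) = Hg(∏_k E_{c(k)}) × Lf(Y, ω₂)`** for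
every polarisation `η` of the product (Lemma 2.15 with `Hom_ℚ = 0` both ways, §5).
[cite: Gordon1997, 2.15 Lemma (p0012 L77–L97)] [cite: Lange2023AbelianVarietiesComplex, §7.2.4 Exercise (4)(a), (c)] -/
theorem IsRiemannForm.lefschetzGroup_pi_comp_prod_eq_of_forall_endAlgRat_eq_bot
    {ω : Fin m → (ℂ [⋀^Fin 2]→L[ℝ] ℝ)} (hω : ∀ j, IsRiemannForm (Φ j) (ω j)) {ω₂ : E₂ [⋀^Fin 2]→L[ℝ] ℝ}
    (h₂ : IsRiemannForm Φ₂ ω₂) {η : ((Fin K → ℂ) × E₂) [⋀^Fin 2]→L[ℝ] ℝ}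
    (hη : IsRiemannForm (prodPeriod (piPeriod fun k ↦ Φ (c k)) Φ₂) η) :
    lefschetzGroup (prodPeriod (piPeriod fun k ↦ Φ (c k)) Φ₂) η =
      ((hodgeGroup (piPeriod fun k ↦ Φ (c k))).prod (lefschetzGroup Φ₂ ω₂)).map (blockDiag (Fin K × Fin 2) ι₂) := by
  rw [hη.lefschetzGroup_eq ((IsRiemannForm.pi fun k ↦ hω (c k)).prod h₂),
    (IsRiemannForm.pi fun k ↦ hω (c k)).lefschetzGroup_prod_eq h₂
      (homRat_pi_comp_eq_bot_of_forall_endAlgRat_eq_bot Φ c Φ₂ hE hhom hc hcomm)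
      (homRat_pi_comp_swap_eq_bot_of_forall_endAlgRat_eq_bot Φ c Φ₂ hE hhom hc hcomm),
    lefschetzGroup_pi_comp_piForm_eq_hodgeGroup_of_forall_endAlgRat_eq_bot Φ c hE hhom hc hω]

include hE hhom hc hcomm in
/-- **THE TRANSFER WITH MULTIPLICITIES: `Hg(Y) = Lf(Y) ⟹ Hg(E_{c(1)} × ⋯ × E_{c(K)} × Y) = Lf(E_{c(1)} × ⋯ × E_{c(K)} × Y, η)`**
for every polarisation `η` — "`X₁ × X₂` again satisfies (D)" in the Hazama–Murty form "`Hg = Sp_D(V, φ)`", group half,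
real points. [cite: MoonenZarhin1999LowDim, §3 Theorem (2) (p0006 L74–L78) with §1 (p0004 L71–L78)]
[cite: Gordon1997, 7.5 Theorem (b) and 2.15 Lemma] [cite: Milne1999LefschetzClasses, §4 Prop. 4.8] -/
theorem IsRiemannForm.hodgeGroup_pi_comp_prod_eq_lefschetzGroup_of_forall_endAlgRat_eq_bot
    {ω : Fin m → (ℂ [⋀^Fin 2]→L[ℝ] ℝ)} (hω : ∀ j, IsRiemannForm (Φ j) (ω j)) {ω₂ : E₂ [⋀^Fin 2]→L[ℝ] ℝ}
    (h₂ : IsRiemannForm Φ₂ ω₂) (hL : hodgeGroup Φ₂ = lefschetzGroup Φ₂ ω₂) {η : ((Fin K → ℂ) × E₂) [⋀^Fin 2]→L[ℝ] ℝ}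
    (hη : IsRiemannForm (prodPeriod (piPeriod fun k ↦ Φ (c k)) Φ₂) η) :
    hodgeGroup (prodPeriod (piPeriod fun k ↦ Φ (c k)) Φ₂) = lefschetzGroup (prodPeriod (piPeriod fun k ↦ Φ (c k)) Φ₂) η :=
  (IsRiemannForm.pi fun k ↦ hω (c k)).hodgeGroup_prod_eq_lefschetzGroup_of_eq h₂
    (hodgeGroup_pi_comp_prod_eq_map_prod_of_forall_endAlgRat_eq_bot Φ c Φ₂ hE hhom hc hcomm)
    (lefschetzGroup_pi_comp_piForm_eq_hodgeGroup_of_forall_endAlgRat_eq_bot Φ c hE hhom hc hω).symm hL hη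

include hE hhom hc hcomm in
/-- **THE CRITERION WITH MULTIPLICITIES: `Hg((∏_k E_{c(k)}) × Y) = Lf((∏_k E_{c(k)}) × Y, η) ⟺ Hg(Y) = Lf(Y, η₂)`** for all
polarisations `η`, `η₂` ((⇒) `N ∈ Lf(Y)` gives `(1 0; 0 N) ∈ Hg(∏E) × Lf(Y) = Lf = Hg ⊆ Hg(∏E) × Hg(Y)`).
[cite: MoonenZarhin1999LowDim, §3 Theorem (2) with §1 (condition (D))] [cite: Gordon1997, 2.15 Lemma and 7.5 Theorem (b)]
[cite: Lange2023AbelianVarietiesComplex, §7.2.4 Exercises (4)(a), (c), (5)] -/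
theorem IsRiemannForm.hodgeGroup_pi_comp_prod_eq_lefschetzGroup_iff_of_forall_endAlgRat_eq_bot
    {ω : Fin m → (ℂ [⋀^Fin 2]→L[ℝ] ℝ)} (hω : ∀ j, IsRiemannForm (Φ j) (ω j)) {ω₂ : E₂ [⋀^Fin 2]→L[ℝ] ℝ}
    (h₂ : IsRiemannForm Φ₂ ω₂) {η : ((Fin K → ℂ) × E₂) [⋀^Fin 2]→L[ℝ] ℝ}
    (hη : IsRiemannForm (prodPeriod (piPeriod fun k ↦ Φ (c k)) Φ₂) η) {η₂ : E₂ [⋀^Fin 2]→L[ℝ] ℝ}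
    (hη₂ : IsRiemannForm Φ₂ η₂) :
    hodgeGroup (prodPeriod (piPeriod fun k ↦ Φ (c k)) Φ₂) = lefschetzGroup (prodPeriod (piPeriod fun k ↦ Φ (c k)) Φ₂) η ↔
      hodgeGroup Φ₂ = lefschetzGroup Φ₂ η₂ := by
  rw [hη₂.lefschetzGroup_eq h₂]
  refine ⟨fun h ↦ le_antisymm h₂.hodgeGroup_le_lefschetzGroup fun N hN ↦ ?_, fun hL ↦
    IsRiemannForm.hodgeGroup_pi_comp_prod_eq_lefschetzGroup_of_forall_endAlgRat_eq_bot Φ c Φ₂ hE hhom hc hcomm hω h₂ hL hη⟩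
  have hmem : blockDiag (Fin K × Fin 2) ι₂ (1, N) ∈ lefschetzGroup (prodPeriod (piPeriod fun k ↦ Φ (c k)) Φ₂) η := by
    rw [hη.lefschetzGroup_eq ((IsRiemannForm.pi fun k ↦ hω (c k)).prod h₂)]
    exact blockDiag_mem_lefschetzGroup_prod (homRat_pi_comp_eq_bot_of_forall_endAlgRat_eq_bot Φ c Φ₂ hE hhom hc hcomm)
      (homRat_pi_comp_swap_eq_bot_of_forall_endAlgRat_eq_bot Φ c Φ₂ hE hhom hc hcomm) (one_mem _) hN
  rw [← h] at hmem
  obtain ⟨⟨A, D⟩, hAD, hEq⟩ := Subgroup.mem_map.1 (hodgeGroup_prod_le _ _ hmem)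
  have hDN : D = N := congrArg Prod.snd (blockDiag_injective _ _ hEq)
  rw [← hDN]
  exact (Subgroup.mem_prod.1 hAD).2

end Lefschetz

/-! ## §7 Elliptic curves `E_{τ_j}`; the locus `Y = ∏ₖ X_k` -/

section Elliptic

variable {m K : ℕ} {τ : Fin m → ℂ} (hτ : ∀ j, (τ j).im ≠ 0) (c : Fin K → Fin m) {ι₂ : Type*} [Fintype ι₂] [DecidableEq ι₂]
  {E₂ : Type*} [NormedAddCommGroup E₂] [NormedSpace ℂ E₂] (Φ₂ : (ι₂ → ℝ) ≃L[ℝ] E₂)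

include hτ in
/-- **`M ∈ Hg(E_{τ_{c(1)}} × ⋯ × E_{τ_{c(K)}} × Y)(ℝ) ⟺ M = ((diag_k A_{c(k)}) 0; 0 N)`, `A ∈ SL₂(ℝ)^m`, `N ∈ Hg(Y)(ℝ)`**,
for pairwise non-isogenous elliptic curves with `End(E_{τ_j}) = ℤ` taken with multiplicities (`c` onto) and ANY torus
`Y` with commutative `Hg(Y)(ℂ)`. [cite: MoonenZarhin1999LowDim, §1 (p0002 L138–L141) and §3 Theorem (2) (p0006 L74–L78)]
[cite: Imai1976HodgeGroups, §3 Remarks (p. 370 L31–L38)] -/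
theorem mem_hodgeGroup_pi_ellipticPeriod_comp_prod_iff (hEnd : ∀ j, ellipticEnd (hτ j) = ⊥)
    (hiso : ∀ i j, i ≠ j → ¬ IsIsogenous (ellipticPeriod (hτ i)) (ellipticPeriod (hτ j))) (hc : Function.Surjective c)
    (hcomm : ∀ M N : SpecialLinearGroup ι₂ ℂ, M ∈ hodgeGroupC Φ₂ → N ∈ hodgeGroupC Φ₂ → M.1 * N.1 = N.1 * M.1)
    {M : SpecialLinearGroup ((Fin K × Fin 2) ⊕ ι₂) ℝ} :
    M ∈ hodgeGroup (prodPeriod (piPeriod fun k ↦ ellipticPeriod (hτ (c k))) Φ₂) ↔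
      ∃ (A : Fin m → SL(2, ℝ)) (N : SpecialLinearGroup ι₂ ℝ), N ∈ hodgeGroup Φ₂ ∧
        M = blockDiag (Fin K × Fin 2) ι₂ (piBlockDiagSL fun k ↦ A (c k), N) :=
  mem_hodgeGroup_pi_comp_prod_iff_of_forall_endAlgRat_eq_bot (fun j ↦ ellipticPeriod (hτ j)) c Φ₂
    (fun j ↦ (endAlgRat_ellipticPeriod_eq_bot_iff (hτ j)).2 (hEnd j))
    (fun i j hij ↦ homRat_ellipticPeriod_eq_bot_of_not_isIsogenous (hτ i) (hτ j) (hiso i j hij)) hc hcomm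

include hτ in
/-- **Imai's §3 Remarks, non-CM classes, real points: `M ∈ Hg(E_{τ_{c(1)}} × ⋯ × E_{τ_{c(K)}})(ℝ) ⟺ M = diag_k A_{c(k)}`,
`A ∈ SL₂(ℝ)^m`** ("`∏_i Δ_{m_i}(Hg(E_i))`"). [cite: Imai1976HodgeGroups, §3 Remarks (p. 370 L31–L38)]
[cite: MoonenZarhin1999LowDim, §1 (p0002 L138–L141) and §3 Corollary] -/
theorem mem_hodgeGroup_pi_ellipticPeriod_comp_iff (hEnd : ∀ j, ellipticEnd (hτ j) = ⊥)
    (hiso : ∀ i j, i ≠ j → ¬ IsIsogenous (ellipticPeriod (hτ i)) (ellipticPeriod (hτ j))) (hc : Function.Surjective c)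
    {M : SpecialLinearGroup (Fin K × Fin 2) ℝ} :
    M ∈ hodgeGroup (piPeriod fun k ↦ ellipticPeriod (hτ (c k))) ↔
      ∃ A : Fin m → SL(2, ℝ), M = piBlockDiagSL fun k ↦ A (c k) :=
  mem_hodgeGroup_pi_comp_iff_of_forall_endAlgRat_eq_bot (fun j ↦ ellipticPeriod (hτ j)) c
    (fun j ↦ (endAlgRat_ellipticPeriod_eq_bot_iff (hτ j)).2 (hEnd j))
    (fun i j hij ↦ homRat_ellipticPeriod_eq_bot_of_not_isIsogenous (hτ i) (hτ j) (hiso i j hij)) hc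

include hτ in
/-- **`Hg(Y) = Lf(Y) ⟹ Hg(E_{τ_{c(1)}} × ⋯ × E_{τ_{c(K)}} × Y) = Lf(·, η)` for every polarisation `η`**, pairwise
non-isogenous curves with `End(E_{τ_j}) = ℤ` taken with multiplicities, `Hg(Y)(ℂ)` commutative.
[cite: MoonenZarhin1999LowDim, §3 Theorem (2) and §3 Corollary] [cite: Gordon1997, 7.5 Theorem (b)] -/
theorem IsRiemannForm.hodgeGroup_pi_ellipticPeriod_comp_prod_eq_lefschetzGroup [FiniteDimensional ℂ E₂]
    (hEnd : ∀ j, ellipticEnd (hτ j) = ⊥)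
    (hiso : ∀ i j, i ≠ j → ¬ IsIsogenous (ellipticPeriod (hτ i)) (ellipticPeriod (hτ j))) (hc : Function.Surjective c)
    (hcomm : ∀ M N : SpecialLinearGroup ι₂ ℂ, M ∈ hodgeGroupC Φ₂ → N ∈ hodgeGroupC Φ₂ → M.1 * N.1 = N.1 * M.1)
    {ω₂ : E₂ [⋀^Fin 2]→L[ℝ] ℝ} (h₂ : IsRiemannForm Φ₂ ω₂) (hL : hodgeGroup Φ₂ = lefschetzGroup Φ₂ ω₂)
    {η : ((Fin K → ℂ) × E₂) [⋀^Fin 2]→L[ℝ] ℝ}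
    (hη : IsRiemannForm (prodPeriod (piPeriod fun k ↦ ellipticPeriod (hτ (c k))) Φ₂) η) :
    hodgeGroup (prodPeriod (piPeriod fun k ↦ ellipticPeriod (hτ (c k))) Φ₂) =
      lefschetzGroup (prodPeriod (piPeriod fun k ↦ ellipticPeriod (hτ (c k))) Φ₂) η := by
  choose ω hω using fun j ↦ isAbelianVariety_ellipticPeriod (hτ j)
  exact IsRiemannForm.hodgeGroup_pi_comp_prod_eq_lefschetzGroup_of_forall_endAlgRat_eq_bot (fun j ↦ ellipticPeriod (hτ j))
    c Φ₂ (fun j ↦ (endAlgRat_ellipticPeriod_eq_bot_iff (hτ j)).2 (hEnd j))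
    (fun i j hij ↦ homRat_ellipticPeriod_eq_bot_of_not_isIsogenous (hτ i) (hτ j) (hiso i j hij)) hc hcomm hω h₂ hL hη

include hτ in
/-- **`D = B` on `Y` ⟹ `D = B` on `E_{τ_{c(1)}} × ⋯ × E_{τ_{c(K)}} × Y`** (all codimensions).
[cite: MoonenZarhin1999LowDim, §3 Theorem (2) and (3.1)] [cite: Gordon1997, §3 Theorem (second bullet)] -/
theorem divisorClasses_pi_ellipticPeriod_comp_prod_eq_hodgeClasses (hEnd : ∀ j, ellipticEnd (hτ j) = ⊥)
    (hiso : ∀ i j, i ≠ j → ¬ IsIsogenous (ellipticPeriod (hτ i)) (ellipticPeriod (hτ j))) (hc : Function.Surjective c)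
    (hcomm : ∀ M N : SpecialLinearGroup ι₂ ℂ, M ∈ hodgeGroupC Φ₂ → N ∈ hodgeGroupC Φ₂ → M.1 * N.1 = N.1 * M.1)
    (hY : ∀ b, divisorClasses Φ₂ b = hodgeClasses Φ₂ b) (p : ℕ) :
    divisorClasses (prodPeriod (piPeriod fun k ↦ ellipticPeriod (hτ (c k))) Φ₂) p =
      hodgeClasses (prodPeriod (piPeriod fun k ↦ ellipticPeriod (hτ (c k))) Φ₂) p :=
  forall_divisorClasses_pi_comp_prod_eq_hodgeClasses_of_forall_endAlgRat_eq_bot (fun j ↦ ellipticPeriod (hτ j)) c Φ₂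
    (fun j ↦ (endAlgRat_ellipticPeriod_eq_bot_iff (hτ j)).2 (hEnd j))
    (fun i j hij ↦ homRat_ellipticPeriod_eq_bot_of_not_isIsogenous (hτ i) (hτ j) (hiso i j hij)) hc hcomm hY p

end Elliptic

/-! ### The locus `Y = ∏ₖ X_k`, unconditionally -/

section Locus

variable {m K : ℕ} (Φ : Fin m → ((Fin 2 → ℝ) ≃L[ℝ] ℂ)) (c : Fin K → Fin m)
  {κ : Type*} [Fintype κ] [DecidableEq κ] {σ : κ → Type*} [∀ k, Fintype (σ k)] [∀ k, DecidableEq (σ k)]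
  {F : κ → Type*} [∀ k, NormedAddCommGroup (F k)] [∀ k, NormedSpace ℂ (F k)] [∀ k, FiniteDimensional ℂ (F k)]
  (Ψ : ∀ k, (σ k → ℝ) ≃L[ℝ] F k)
  (hE : ∀ j, endAlgRat (Φ j) = ⊥) (hhom : ∀ i j, i ≠ j → homRat (Φ i) (Φ j) = ⊥) (hc : Function.Surjective c)

include hE hhom hc in
/-- **HODGE = LEFSCHETZ AND `D = B` FOR `E_{c(1)} × ⋯ × E_{c(K)} × ∏ₖ X_k`, UNCONDITIONALLY** — pairwise `Hom_ℚ = 0` curves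
without complex multiplication WITH MULTIPLICITIES times any finite family of positive-dimensional tori on the Hodge-circle
locus: `Hg = Lf` for every polarisation `η` (g33's `Lf(∏ₖ X_k) = Hg(∏ₖ X_k)`, g35-#2's commutativity, §6).
[cite: MoonenZarhin1999LowDim, §3 Theorem (2) and §3 Corollary ("every product of elliptic curves satisfies condition (D)")]
[cite: Gordon1997, 7.5 Theorem (b) and §3 Theorem] [cite: Lange2023AbelianVarietiesComplex, §7.2.4 Exercises (4), (5)] -/
theorem IsRiemannForm.hodgeGroup_pi_comp_prod_sigmaPiPeriod_eq_lefschetzGroup {ω : Fin m → (ℂ [⋀^Fin 2]→L[ℝ] ℝ)}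
    (hω : ∀ j, IsRiemannForm (Φ j) (ω j)) (hg : ∀ k, 0 < finrank ℂ (F k))
    (h : ∀ k, (hodgeGroup (Ψ k) : Set (SpecialLinearGroup (σ k) ℝ)) = Set.range (hodgeCircleSL (Ψ k)))
    {η : ((Fin K → ℂ) × ∀ k, F k) [⋀^Fin 2]→L[ℝ] ℝ}
    (hη : IsRiemannForm (prodPeriod (piPeriod fun k ↦ Φ (c k)) (sigmaPiPeriod Ψ)) η) :
    hodgeGroup (prodPeriod (piPeriod fun k ↦ Φ (c k)) (sigmaPiPeriod Ψ)) =
      lefschetzGroup (prodPeriod (piPeriod fun k ↦ Φ (c k)) (sigmaPiPeriod Ψ)) η := by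
  obtain ⟨ω₂, h₂⟩ := isAbelianVariety_sigmaPiPeriod_of_coe_eq_range Ψ hg h
  exact IsRiemannForm.hodgeGroup_pi_comp_prod_eq_lefschetzGroup_of_forall_endAlgRat_eq_bot Φ c (sigmaPiPeriod Ψ) hE hhom hc
    (fun _ _ hM hN ↦ congrArg Subtype.val (hodgeGroupC_sigmaPiPeriod_comm_of_coe_eq_range Ψ h hM hN)) hω h₂
    (h₂.lefschetzGroup_sigmaPiPeriod_eq_hodgeGroup_of_coe_eq_range Ψ hg h).symm hη

include hE hhom hc in
/-- **`D = B` on `E_{c(1)} × ⋯ × E_{c(K)} × ∏ₖ X_k` in every codimension, unconditionally** (g33/g35: `D = B` on `∏ₖ X_k`).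
[cite: MoonenZarhin1999LowDim, §3 Theorem (2), (3.1) and §3 Corollary] [cite: Gordon1997, §3 Theorem (second bullet)] -/
theorem divisorClasses_pi_comp_prod_sigmaPiPeriod_eq_hodgeClasses (hg : ∀ k, 0 < finrank ℂ (F k))
    (h : ∀ k, (hodgeGroup (Ψ k) : Set (SpecialLinearGroup (σ k) ℝ)) = Set.range (hodgeCircleSL (Ψ k))) (p : ℕ) :
    divisorClasses (prodPeriod (piPeriod fun k ↦ Φ (c k)) (sigmaPiPeriod Ψ)) p =
      hodgeClasses (prodPeriod (piPeriod fun k ↦ Φ (c k)) (sigmaPiPeriod Ψ)) p :=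
  forall_divisorClasses_pi_comp_prod_eq_hodgeClasses_of_forall_endAlgRat_eq_bot Φ c (sigmaPiPeriod Ψ) hE hhom hc
    (fun _ _ hM hN ↦ congrArg Subtype.val (hodgeGroupC_sigmaPiPeriod_comm_of_coe_eq_range Ψ h hM hN))
    (fun b ↦ divisorClasses_sigmaPiPeriod_eq_hodgeClasses_of_coe_eq_range Ψ hg h b) p

end Locus

end ComplexTorus

end Literature.Geometry.Kaehler

end
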